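import Literature.MathematicalPhysics.QuantumLattice.EmeryThreeBandThermalPressure
import HarnessLib

/-!
# The `T > 0` pressure CAP from a `T = 0` FLOOR valid for all states: `P_q(β,Ψ) ≤ 2 log 2 − β·m` — every certified three-band Anderson cluster floor
# (La₂CuO₄, Hg-1201 plus certificates already in the tree) is at once a certified cap on `emeryCellPressure β θ` at every temperature

Topic `Literature/MathematicalPhysics/QuantumLattice` (family `hubbard`; crew hubbard-fast S2 «multi-band × T > 0», seat hubbard-box-p1). The CAP half of the
three-band `T > 0` window (`EmeryThreeBandThermalPressure.emeryCellPressure_le_log_partitionFn_boost`, `EmeryThreeBandBlock2x2BoostSectorCap`) wants new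
device runs on a boosted 12-site cluster. There is a device-FREE cap, as sharp in the `β → ∞` slope as the certified `T = 0` floor it is made of: the
periodic variational pressure is `sup_ω [s̄(ω) − β ē(ω)]`, the entropy density of any state is `≤ 2 log 2` per site, and a weighted open-cluster certificate
`H^w_B[Ψ] + G − q₀·1 ⪰ 0` bounds `ē(ω)` from below for EVERY periodic `ω` (all fillings at once — the certificate is on the whole cluster Fock space). Hence:

* §1 (generic, any `q`-periodic model) **`perVarPressure_le_of_forall_cellMeanEnergy_ge`**: `β ≥ 0` and `m ≤ ē_q(Ψ)(ω)` for every `q`-periodic `ω` give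
  `P_q(β,Ψ,R) ≤ 2 log 2 − β·m`; from a weighted cluster certificate with an `L_q`-admissible weight of mass `M`
  (`perVarPressure_le_of_posSemidef_reweight`): `P_q ≤ 2 log 2 − β (q₀ − w(∅)Ψ∅)/(M|C|)`.
* §2 (three-band) **`emeryCellPressure_le_of_windowCertificate`**: for a window `B ⊇` the `CuO₄` plus, the uniform `(2ℤ)²`-weight of mass `M > 0`, any multiplier
  `G` killed by `2×2`-periodic states and a certificate `H^w_B[emeryInteraction θ] + G − q₀·1 ⪰ 0`:  **`emeryCellPressure β θ ≤ 6 log 2 − β·q₀/M`** (`β ≥ 0`) —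
  LITERALLY the hypotheses of the `T = 0` floor door `le_emeryEnergyDensity_of_cuO4WindowCertificate'` (hubbard-downfold-mod-4's La₂CuO₄ / Hg-1201 words
  discharge them with hubbard-box-p2's `kgp1x5_*` certificates), so every landed three-band floor word is a `T > 0` pressure cap word with no new computation;
  plus / general-weight forms; and the trivial companion FLOOR `−β·e ≤ 4·emeryCellPressure β θ·…` from any trial energy is `neg_mul_le_emeryCellPressure_of_rayleigh`
  (`EmeryThreeBandThermalClusterVectorFloor`) — together: **the `T > 0` window of width `β·(E_cap − E_floor) + 6 log 2` per `CuO₂` from the `T = 0` window alone**.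
* §3 the free-energy reading: `f_cell(β,θ) := −emeryCellPressure/β ≥ q₀/M − 6 log 2/β` (`β > 0`) — the `T = 0` floor minus the maximal entropy times `T`.

Everything is PROVED (0 sorry); no definition, no named fact, no number. HONEST SCOPE: a crude cap (full entropy `6 log 2` per `CuO₂` is never reduced); the
cluster route (`…BoostSectorCap`) improves the constant, not the slope; neither resolves thermal scales (`k_B T ≈ 0.03 eV` ≪ the `T = 0` window width).

## Tree / Mathlib search

REUSED: `perVarPressure_le`, `entropyDensitySup_le` (`PeriodicVariationalPressure`, `TIVariationalPressure`); `IsPeriodic.le_mul_cellMeanEnergy_of_posSemidef_reweight`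
(`WeightedOpenClusterBoundsPeriodic`); `uniformPeriodicWeight(_admissible/_empty)` (`WeightedOpenClusterUniformWeightsPeriodic`); `emeryWindow_fit_of_cuO4_subset`
(`EmeryThreeBandWindowFloorsPlus`); `emeryPressure`, `emeryCellPressure`, `card_cell_liebPeriods_eq` (`EmeryThreeBandThermalPressure`); `emeryInteraction_structure`,
`emeryInteraction_apply_empty`. `lean search 'perVarPressure_le_of_forall|Pressure_le.*posSemidef'` (2026-08-28): nothing (the one-band canonical analogue is
`pressureTT'₂_le_binEntropy_add_sub_energy`).

## References

* R. B. Israel, *Convexity in the Theory of Lattice Gases* (1979), Thm. I.2.4, Lemma II.3.1. [cite: Israel1979, Thm. I.2.4]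
* P. W. Anderson, Phys. Rev. 83 (1951) 1260, eq. (2); R. Valentí, J. Stolze, P. J. Hirschfeld, Phys. Rev. B 43 (1991) 13743, §II. [cite: ValentiStolzeHirschfeld1991, §II]
* H. Araki, H. Moriya, Rev. Math. Phys. 15 (2003) 93, Theorem 3.8 and §10 (entropy density ≤ log dim). [cite: ArakiMoriya2003, Theorem 3.8 and §10]
-/

noncomputable section

open scoped ComplexOrder BigOperators
open Finset

namespace Literature.MathematicalPhysics.QuantumLattice

open Matrix HubbardWave0 Literature.Probability.LatticeModels ThermodynamicLimit InfVolFermionState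

/-! ### §1. Generic: a floor on the cell energy of all periodic states caps the pressure -/

namespace FermionInteraction

variable {d : ℕ} {q : Fin d → ℕ} {Ψ : FermionInteraction d} {R : ℝ}

/-- **`T = 0` FLOOR ⇒ `T > 0` CAP**: if `m ≤ ē_q(Ψ)(ω)` for every `q`-periodic `ω` and `β ≥ 0`, then `P_q(β,Ψ,R) ≤ 2 log 2 − β·m` (entropy density ≤ `2 log 2`
per site). [cite: Israel1979, Thm. I.2.4] [cite: ArakiMoriya2003, Theorem 3.8 and §10] -/
theorem perVarPressure_le_of_forall_cellMeanEnergy_ge {β : ℝ} (hβ : 0 ≤ β) {m : ℝ}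
    (hm : ∀ ω : InfVolFermionState d, ω.IsPeriodic q → m ≤ cellMeanEnergy q Ψ ω R) :
    Ψ.perVarPressure β q R ≤ 2 * Real.log 2 - β * m :=
  Ψ.perVarPressure_le β q R fun ω hω => by
    have hs := ω.entropyDensitySup_le
    have he := mul_le_mul_of_nonneg_left (hm ω hω) hβ
    linarith

/-- **From a weighted open-cluster certificate** (`d ≥ 1`; `Ψ` `q`-periodic of finite range `R`; `w` an `L_q`-admissible weight of mass `M > 0` on a window
`B`; `G` killed by `q`-periodic states; `H^w_B[Ψ] + G − q₀·1 ⪰ 0`): `P_q(β,Ψ,R) ≤ 2 log 2 − β·(q₀ − w(∅)(Ψ∅)_{∅∅})/(M·|C|)` (`β ≥ 0`).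
[cite: ValentiStolzeHirschfeld1991, §II] [cite: Israel1979, Thm. I.2.4] -/
theorem perVarPressure_le_of_posSemidef_reweight (hΨ : Ψ.IsPeriodic q) (hR : Ψ.HasFiniteRange R) {β : ℝ} (hβ : 0 ≤ β)
    (B : Finset (Site d)) (w : Finset (Site d) → ℝ) {M : ℝ} (hM : 0 < M)
    (hw : ∀ (c : Cell q) (X : Finset (Site d)), cellPos c ∈ X → Ψ.Φ X ≠ 0 →
      ∑ y ∈ B with (cellRes q y = c ∧ shiftSet (y - cellPos c) X ⊆ B), w (shiftSet (y - cellPos c) X) = M)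
    {G : FermionOp B} (hG0 : ∀ ω' : InfVolFermionState d, ω'.IsPeriodic q → (ω'.expect B G).re = 0) {q₀ : ℝ}
    (hq : ((⟨fun X => (w X : ℂ) • Ψ.Φ X⟩ : FermionInteraction d).localHamiltonian B + G - (q₀ : ℂ) • (1 : FermionOp B)).PosSemidef) :
    Ψ.perVarPressure β q R ≤ 2 * Real.log 2 - β * ((q₀ - w ∅ * ((Ψ.Φ ∅) ∅ ∅).re) / (M * Fintype.card (Cell q))) := by
  have hC : (0 : ℝ) < Fintype.card (Cell q) := by exact_mod_cast Fintype.card_pos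
  refine perVarPressure_le_of_forall_cellMeanEnergy_ge hβ fun ω hω => ?_
  have h := hω.le_mul_cellMeanEnergy_of_posSemidef_reweight hΨ hR B w M hw hG0 hq
  rw [div_le_iff₀ (mul_pos hM hC)]
  linarith

end FermionInteraction

/-! ### §2. Three-band: every `T = 0` cluster floor is a `T > 0` pressure cap -/

/-- **Three-band, all-states floor ⇒ cap**: `m ≤ ē(emeryInteraction θ)(ω)` for every `2×2`-periodic `ω` and `β ≥ 0` give
`emeryPressure β θ ≤ 2 log 2 − β m` and `emeryCellPressure β θ ≤ 6 log 2 − 4β m`. [cite: Israel1979, Thm. I.2.4] -/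
theorem emeryCellPressure_le_of_forall_floor {β : ℝ} (hβ : 0 ≤ β) (θ : Fin 14 → ℝ) {m : ℝ}
    (hm : ∀ ω : InfVolFermionState 2, ω.IsPeriodic liebPeriods → m ≤ cellMeanEnergy liebPeriods (emeryInteraction θ) ω 1) :
    emeryPressure β θ ≤ 2 * Real.log 2 - β * m ∧ emeryCellPressure β θ ≤ 6 * Real.log 2 - 4 * β * m := by
  have h := (emeryInteraction θ).perVarPressure_le_of_forall_cellMeanEnergy_ge (q := liebPeriods) (R := 1) hβ hm
  refine ⟨h, ?_⟩
  rw [emeryCellPressure, emeryPressure]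
  linarith

/-- **THE `T > 0` CAP FROM A `T = 0` WINDOW CERTIFICATE.** For a window `B ⊇` the `CuO₄` plus, the uniform `(2ℤ)²`-weight of mass `M > 0`, a multiplier `G`
killed by `2×2`-periodic states, a certificate `H^w_B[emeryInteraction θ] + G − q₀·1 ⪰ 0` and `β ≥ 0`: **`emeryCellPressure β θ ≤ 6 log 2 − β·q₀/M`** — the
hypotheses of `le_emeryEnergyDensity_of_cuO4WindowCertificate'`, verbatim. [cite: ValentiStolzeHirschfeld1991, §II] [cite: Israel1979, Thm. I.2.4] -/
theorem emeryCellPressure_le_of_windowCertificate {β : ℝ} (hβ : 0 ≤ β) (θ : Fin 14 → ℝ) {B : Finset (Site 2)} (hB : emeryCuO4Window ⊆ B)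
    {M : ℝ} (hM : 0 < M) {G : FermionOp B} (hG0 : ∀ ω' : InfVolFermionState 2, ω'.IsPeriodic liebPeriods → (ω'.expect B G).re = 0) {q₀ : ℝ}
    (hq : ((⟨fun X => (uniformPeriodicWeight liebPeriods B M X : ℂ) • (emeryInteraction θ).Φ X⟩ : FermionInteraction 2).localHamiltonian B + G -
      (q₀ : ℂ) • (1 : FermionOp B)).PosSemidef) :
    emeryCellPressure β θ ≤ 6 * Real.log 2 - β * (q₀ / M) := by
  obtain ⟨-, -, hP, hR⟩ := emeryInteraction_structure θ
  have h := (emeryInteraction θ).perVarPressure_le_of_posSemidef_reweight (q := liebPeriods) (R := 1) hP hR hβ B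
    (uniformPeriodicWeight liebPeriods B M) hM (uniformPeriodicWeight_admissible B M (emeryWindow_fit_of_cuO4_subset θ hB)) hG0 hq
  rw [uniformPeriodicWeight_empty, zero_mul, sub_zero, card_cell_liebPeriods_eq] at h
  rw [emeryCellPressure, emeryPressure]
  have e : q₀ / (M * ((4 : ℕ) : ℝ)) = q₀ / M / 4 := by push_cast; rw [div_div]
  rw [e] at h
  linarith

/-- **The plus-window form** (`B = emeryCuO4Window`). [cite: ValentiStolzeHirschfeld1991, §II] [cite: Israel1979, Thm. I.2.4] -/
theorem emeryCellPressure_le_of_cuO4Certificate {β : ℝ} (hβ : 0 ≤ β) (θ : Fin 14 → ℝ) {M : ℝ} (hM : 0 < M)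
    {G : FermionOp emeryCuO4Window} (hG0 : ∀ ω' : InfVolFermionState 2, ω'.IsPeriodic liebPeriods → (ω'.expect emeryCuO4Window G).re = 0) {q₀ : ℝ}
    (hq : ((⟨fun X => (uniformPeriodicWeight liebPeriods emeryCuO4Window M X : ℂ) • (emeryInteraction θ).Φ X⟩ : FermionInteraction 2).localHamiltonian
      emeryCuO4Window + G - (q₀ : ℂ) • (1 : FermionOp emeryCuO4Window)).PosSemidef) :
    emeryCellPressure β θ ≤ 6 * Real.log 2 - β * (q₀ / M) :=
  emeryCellPressure_le_of_windowCertificate hβ θ subset_rfl hM hG0 hq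

/-- **General admissible weight** (any window `B`, any `L_{(2,2)}`-admissible weight `w` of mass `M > 0`): `emeryCellPressure β θ ≤ 6 log 2 − β·q₀/M`.
[cite: ValentiStolzeHirschfeld1991, §II] [cite: Israel1979, Thm. I.2.4] -/
theorem emeryCellPressure_le_of_reweightCertificate {β : ℝ} (hβ : 0 ≤ β) (θ : Fin 14 → ℝ) (B : Finset (Site 2)) (w : Finset (Site 2) → ℝ)
    {M : ℝ} (hM : 0 < M)
    (hw : ∀ (c : Cell liebPeriods) (X : Finset (Site 2)), cellPos c ∈ X → (emeryInteraction θ).Φ X ≠ 0 →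
      ∑ y ∈ B with (cellRes liebPeriods y = c ∧ shiftSet (y - cellPos c) X ⊆ B), w (shiftSet (y - cellPos c) X) = M)
    {G : FermionOp B} (hG0 : ∀ ω' : InfVolFermionState 2, ω'.IsPeriodic liebPeriods → (ω'.expect B G).re = 0) {q₀ : ℝ}
    (hq : ((⟨fun X => (w X : ℂ) • (emeryInteraction θ).Φ X⟩ : FermionInteraction 2).localHamiltonian B + G - (q₀ : ℂ) • (1 : FermionOp B)).PosSemidef) :
    emeryCellPressure β θ ≤ 6 * Real.log 2 - β * (q₀ / M) := by
  obtain ⟨-, -, hP, hR⟩ := emeryInteraction_structure θ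
  have h := (emeryInteraction θ).perVarPressure_le_of_posSemidef_reweight (q := liebPeriods) (R := 1) hP hR hβ B w hM hw hG0 hq
  rw [emeryInteraction_apply_empty, Matrix.zero_apply, Complex.zero_re, mul_zero, sub_zero, card_cell_liebPeriods_eq] at h
  rw [emeryCellPressure, emeryPressure]
  have e : q₀ / (M * ((4 : ℕ) : ℝ)) = q₀ / M / 4 := by push_cast; rw [div_div]
  rw [e] at h
  linarith

/-! ### §3. The free-energy reading -/

/-- **Free energy per `CuO₂` from a `T = 0` certificate**: `−emeryCellPressure β θ / β ≥ q₀/M − 6 log 2 / β` for `β > 0` — the `T = 0` floor minus the maximal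
entropy times the temperature. [cite: Israel1979, Thm. I.2.4] -/
theorem neg_emeryCellPressure_div_ge_of_windowCertificate {β : ℝ} (hβ : 0 < β) (θ : Fin 14 → ℝ) {B : Finset (Site 2)} (hB : emeryCuO4Window ⊆ B)
    {M : ℝ} (hM : 0 < M) {G : FermionOp B} (hG0 : ∀ ω' : InfVolFermionState 2, ω'.IsPeriodic liebPeriods → (ω'.expect B G).re = 0) {q₀ : ℝ}
    (hq : ((⟨fun X => (uniformPeriodicWeight liebPeriods B M X : ℂ) • (emeryInteraction θ).Φ X⟩ : FermionInteraction 2).localHamiltonian B + G -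
      (q₀ : ℂ) • (1 : FermionOp B)).PosSemidef) :
    q₀ / M - 6 * Real.log 2 / β ≤ -emeryCellPressure β θ / β := by
  have h := emeryCellPressure_le_of_windowCertificate hβ.le θ hB hM hG0 hq
  rw [le_div_iff₀ hβ, sub_mul, div_mul_cancel₀ _ hβ.ne']
  linarith

end Literature.MathematicalPhysics.QuantumLattice

end
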